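import Summits.Ventures.CertifiedManyBodySolver.Observables.PinningFieldSqrtTwoGridReaders
import HarnessLib

/-!
# The HF–BCS sourced cap (IX): the UNIFORM-in-`L` grand-canonical cap row at a grid field from `π`-FREE certified data
# (interval enclosures of the two momentum sums + rational slack tests) — so that the cap side of the B′1/B′2 floors is a CLAIM NODE
# in the shape of the certificate itself

HONEST FRAMING: zero compute; implication only. `sourcedEnergyUpperRow_sqrtTwoMul_of_kSpace_grid` (p480671) reads the uniform row
`SourcedEnergyUpperRow 0 U μ (√2 g) 1 L₁ e` from ONE inequality `hnum` that still contains `π` (the two-grid Lipschitz slacks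
`2C₁/L₁`, `2C₂/L₁`) and the raw sums; a claim node cannot carry `π`. This file splits `hnum` into (i) the certified content — `s ≤ L₁⁻²Σ E t`,
`a ≤ L₁⁻²Σ(1 − ξt/E) ≤ b` (exactly the `S1`, `n` enclosures of the cell's two-engine tables) — and (ii) decidable rational tests: slack bounds
`2·(2·3.141593·(3/2)(2 + 4g)) ≤ ε·L₁`, `2·(2·3.141593·β(3 + 4g)) ≤ δ·L₁` (`π < 3.141593`, Mathlib `Real.pi_lt_d6`) and the envelope
`−(s − ε) − μ' + max[(μ' − μ)(a − δ) + U(a − δ)²/4, (μ' − μ)(b + δ) + U(b + δ)²/4] ≤ e` (the quadratic is convex for `U ≥ 0`, so widening the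
density interval only raises the max, `quad_le_max_endpoints`). Answer (a′) to hubbard-cq-p1 (2026-08-27T02:50:58Z): the obs-side cap nodes are
stated in this `π`-free shape and discharged to the `hcap` rows of `pinFloorAt_U2_mu1o2_g*_of_GU2node` by this reader. A variational cap;
nothing about order by itself; not a superconductivity verdict.

References: Davis–Rabinowitz (1984) §2.1 (2.1.6) [DavisRabinowitz1984]; Bach–Lieb–Solovej (1994) §2 [BachLiebSolovej1994].
-/

noncomputable section

open Real Finset Literature.MathematicalPhysics.QuantumLattice Literature.Probability.LatticeModels
open Literature.MathematicalPhysics.QuantumLattice.HubbardWave0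

namespace Summit.Ventures.CertifiedManyBodySolver.Observables

/-- **UNIFORM-in-`L` HF–BCS cap row at a grid field from interval data and real slack bounds** (`L₁ ≥ 3`, `β ≥ 0`, `U ≥ 0`, `g ≥ 0`):
if `s ≤ L₁⁻²Σ_k E_k t_k`, `a ≤ L₁⁻²Σ_k(1 − ξ_k t_k/E_k) ≤ b`, `2C₁/L₁ ≤ ε`, `2C₂/L₁ ≤ δ` (`C₁ = 2π(3/2)(2 + 4g)`, `C₂ = 2πβ(3 + 4g)`) and
`−(s − ε) − μ' + max[(μ' − μ)(a − δ) + U(a − δ)²/4, (μ' − μ)(b + δ) + U(b + δ)²/4] ≤ e`, then `SourcedEnergyUpperRow 0 U μ (√2 g) 1 L₁ e`.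
[cite: DavisRabinowitz1984, §2.1 eq. (2.1.6)] [cite: BachLiebSolovej1994, §2] -/
theorem sourcedEnergyUpperRow_sqrtTwoMul_of_kSpace_grid_of_enclosures (L₁ : ℕ) [NeZero L₁] (hL₁ : 3 ≤ L₁) (U μ μ' β : ℝ)
    (hβ : 0 ≤ β) (hU : 0 ≤ U) {g : ℚ} (hg : 0 ≤ g) {s a b δ ε : ℝ} {e : ℚ}
    (hs : s ≤ (∑ k : TorusSite 2 L₁, Real.sqrt ((torusBand L₁ k - μ') ^ 2 + (4 * (g : ℝ) * dWaveGap k) ^ 2) * Real.tanh (β * Real.sqrt ((torusBand L₁ k - μ') ^ 2 + (4 * (g : ℝ) * dWaveGap k) ^ 2) / 2)) / (L₁ : ℝ) ^ 2)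
    (ha : a ≤ (∑ k : TorusSite 2 L₁, (1 - (torusBand L₁ k - μ') * Real.tanh (β * Real.sqrt ((torusBand L₁ k - μ') ^ 2 + (4 * (g : ℝ) * dWaveGap k) ^ 2) / 2) / Real.sqrt ((torusBand L₁ k - μ') ^ 2 + (4 * (g : ℝ) * dWaveGap k) ^ 2))) / (L₁ : ℝ) ^ 2)
    (hb : (∑ k : TorusSite 2 L₁, (1 - (torusBand L₁ k - μ') * Real.tanh (β * Real.sqrt ((torusBand L₁ k - μ') ^ 2 + (4 * (g : ℝ) * dWaveGap k) ^ 2) / 2) / Real.sqrt ((torusBand L₁ k - μ') ^ 2 + (4 * (g : ℝ) * dWaveGap k) ^ 2))) / (L₁ : ℝ) ^ 2 ≤ b)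
    (hε : 2 * (2 * π * (3 / 2 * (2 + 4 * (g : ℝ)))) / (L₁ : ℝ) ≤ ε) (hδ : 2 * (2 * π * (β * (3 + 4 * (g : ℝ)))) / (L₁ : ℝ) ≤ δ)
    (henv : -(s - ε) - μ' + max ((μ' - μ) * (a - δ) + U * (a - δ) ^ 2 / 4) ((μ' - μ) * (b + δ) + U * (b + δ) ^ 2 / 4) ≤ ((e : ℚ) : ℝ)) :
    SourcedEnergyUpperRow 0 U μ (Real.sqrt 2 * (g : ℝ)) 1 L₁ e := by
  refine sourcedEnergyUpperRow_sqrtTwoMul_of_kSpace_grid L₁ hL₁ U μ μ' β hβ hU hg ?_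
  generalize hA₁ : (∑ k : TorusSite 2 L₁, Real.sqrt ((torusBand L₁ k - μ') ^ 2 + (4 * (g : ℝ) * dWaveGap k) ^ 2) * Real.tanh (β * Real.sqrt ((torusBand L₁ k - μ') ^ 2 + (4 * (g : ℝ) * dWaveGap k) ^ 2) / 2)) = A₁ at hs ⊢
  generalize hB₁ : (∑ k : TorusSite 2 L₁, (1 - (torusBand L₁ k - μ') * Real.tanh (β * Real.sqrt ((torusBand L₁ k - μ') ^ 2 + (4 * (g : ℝ) * dWaveGap k) ^ 2) / 2) / Real.sqrt ((torusBand L₁ k - μ') ^ 2 + (4 * (g : ℝ) * dWaveGap k) ^ 2))) = B₁ at ha hb ⊢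
  generalize hc1 : (2 * π * (3 / 2 * (2 + 4 * (g : ℝ)))) = c₁ at hε ⊢
  generalize hc2 : (2 * π * (β * (3 + 4 * (g : ℝ)))) = c₂ at hδ ⊢
  -- the two endpoint densities `n₁ ∓ 2c₂/L₁` lie in `[a − δ, b + δ]`
  have hlo : a - δ ≤ B₁ / (L₁ : ℝ) ^ 2 - 2 * c₂ / (L₁ : ℝ) := by linarith
  have hlo' : B₁ / (L₁ : ℝ) ^ 2 - 2 * c₂ / (L₁ : ℝ) ≤ b + δ := by
    have : 0 ≤ 2 * c₂ / (L₁ : ℝ) := by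
      have h0 : 2 * c₂ / (L₁ : ℝ) ≤ δ := hδ
      rw [← hc2]; positivity
    linarith
  have hhi : a - δ ≤ B₁ / (L₁ : ℝ) ^ 2 + 2 * c₂ / (L₁ : ℝ) := by
    have : 0 ≤ 2 * c₂ / (L₁ : ℝ) := by rw [← hc2]; positivity
    linarith
  have hhi' : B₁ / (L₁ : ℝ) ^ 2 + 2 * c₂ / (L₁ : ℝ) ≤ b + δ := by linarith
  have q1 := quad_le_max_endpoints (c := μ' - μ) hU hlo hlo'
  have q2 := quad_le_max_endpoints (c := μ' - μ) hU hhi hhi'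
  have hmax : max ((μ' - μ) * (B₁ / (L₁ : ℝ) ^ 2 - 2 * c₂ / (L₁ : ℝ)) + U * (B₁ / (L₁ : ℝ) ^ 2 - 2 * c₂ / (L₁ : ℝ)) ^ 2 / 4)
      ((μ' - μ) * (B₁ / (L₁ : ℝ) ^ 2 + 2 * c₂ / (L₁ : ℝ)) + U * (B₁ / (L₁ : ℝ) ^ 2 + 2 * c₂ / (L₁ : ℝ)) ^ 2 / 4) ≤
      max ((μ' - μ) * (a - δ) + U * (a - δ) ^ 2 / 4) ((μ' - μ) * (b + δ) + U * (b + δ) ^ 2 / 4) := max_le q1 q2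
  linarith

/-- `π`-free slack tests at a grid field (rationals `g ≥ 0`, `β ≥ 0`): `2·(2·3.141593·(3/2)(2 + 4g)) ≤ ε·L₁` gives `2C₁/L₁ ≤ ε`, and
`2·(2·3.141593·β(3 + 4g)) ≤ δ·L₁` gives `2C₂/L₁ ≤ δ` (`π < 3.141593`). [folklore] -/
private theorem two_mul_slacks_le_of_rat (L₁ : ℕ) [NeZero L₁] {g β δ ε : ℚ} (hg : 0 ≤ g) (hβ : 0 ≤ β)
    (hε : 2 * (2 * (3141593 / 10 ^ 6 : ℚ) * (3 / 2 * (2 + 4 * g))) ≤ ε * L₁)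
    (hδ : 2 * (2 * (3141593 / 10 ^ 6 : ℚ) * (β * (3 + 4 * g))) ≤ δ * L₁) :
    2 * (2 * π * (3 / 2 * (2 + 4 * ((g : ℚ) : ℝ)))) / (L₁ : ℝ) ≤ ((ε : ℚ) : ℝ) ∧
      2 * (2 * π * (((β : ℚ) : ℝ) * (3 + 4 * ((g : ℚ) : ℝ)))) / (L₁ : ℝ) ≤ ((δ : ℚ) : ℝ) := by
  have hL : (0 : ℝ) < (L₁ : ℝ) := Nat.cast_pos.2 (Nat.pos_of_ne_zero (NeZero.ne L₁))
  have hg' : (0 : ℝ) ≤ (g : ℝ) := by exact_mod_cast hg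
  have hβ' : (0 : ℝ) ≤ (β : ℝ) := by exact_mod_cast hβ
  have hε' : (((2 * (2 * (3141593 / 10 ^ 6 : ℚ) * (3 / 2 * (2 + 4 * g))) : ℚ)) : ℝ) ≤ (((ε * L₁ : ℚ)) : ℝ) := Rat.cast_le.2 hε
  have hδ' : (((2 * (2 * (3141593 / 10 ^ 6 : ℚ) * (β * (3 + 4 * g))) : ℚ)) : ℝ) ≤ (((δ * L₁ : ℚ)) : ℝ) := Rat.cast_le.2 hδ
  push_cast at hε' hδ'
  have hπ := Real.pi_lt_d6
  have hm1 : 0 ≤ (3 / 2 : ℝ) * (2 + 4 * (g : ℝ)) := by positivity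
  have hm2 : 0 ≤ (β : ℝ) * (3 + 4 * (g : ℝ)) := by positivity
  constructor
  · rw [div_le_iff₀ hL]; nlinarith
  · rw [div_le_iff₀ hL]; nlinarith

/-- **UNIFORM-in-`L` HF–BCS cap row at a grid field from `π`-FREE certified data, RATIONAL SLOTS**: the certified enclosures
`s ≤ L₁⁻²Σ E t`, `a ≤ L₁⁻²Σ(1 − ξt/E) ≤ b` (hypotheses — the content of a cap claim node) plus the decidable tests
`2·(2·3.141593·(3/2)(2 + 4g)) ≤ ε·L₁`, `2·(2·3.141593·β(3 + 4g)) ≤ δ·L₁`,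
`−(s − ε) − μ' + max[(μ' − μ)(a − δ) + U(a − δ)²/4, (μ' − μ)(b + δ) + U(b + δ)²/4] ≤ e` give `SourcedEnergyUpperRow 0 U μ (√2 g) 1 L₁ e`
(every torus `L ≥ L₁`) — the `hcap` row of hubbard-cq-p1's `pinFloorAt_U2_mu1o2_g*_of_GU2node`. [cite: DavisRabinowitz1984, §2.1 eq. (2.1.6)]
[cite: BachLiebSolovej1994, §2] -/
theorem sourcedEnergyUpperRow_sqrtTwoMul_of_kSpace_enclosures_rat (L₁ : ℕ) [NeZero L₁] (hL₁ : 3 ≤ L₁)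
    {U μ μ' β g s a b δ ε e : ℚ} (hU : 0 ≤ U) (hβ : 0 ≤ β) (hg : 0 ≤ g)
    (hs : ((s : ℚ) : ℝ) ≤ (∑ k : TorusSite 2 L₁, Real.sqrt ((torusBand L₁ k - ((μ' : ℚ) : ℝ)) ^ 2 + (4 * ((g : ℚ) : ℝ) * dWaveGap k) ^ 2) * Real.tanh (((β : ℚ) : ℝ) * Real.sqrt ((torusBand L₁ k - ((μ' : ℚ) : ℝ)) ^ 2 + (4 * ((g : ℚ) : ℝ) * dWaveGap k) ^ 2) / 2)) / (L₁ : ℝ) ^ 2)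
    (ha : ((a : ℚ) : ℝ) ≤ (∑ k : TorusSite 2 L₁, (1 - (torusBand L₁ k - ((μ' : ℚ) : ℝ)) * Real.tanh (((β : ℚ) : ℝ) * Real.sqrt ((torusBand L₁ k - ((μ' : ℚ) : ℝ)) ^ 2 + (4 * ((g : ℚ) : ℝ) * dWaveGap k) ^ 2) / 2) / Real.sqrt ((torusBand L₁ k - ((μ' : ℚ) : ℝ)) ^ 2 + (4 * ((g : ℚ) : ℝ) * dWaveGap k) ^ 2))) / (L₁ : ℝ) ^ 2)
    (hb : (∑ k : TorusSite 2 L₁, (1 - (torusBand L₁ k - ((μ' : ℚ) : ℝ)) * Real.tanh (((β : ℚ) : ℝ) * Real.sqrt ((torusBand L₁ k - ((μ' : ℚ) : ℝ)) ^ 2 + (4 * ((g : ℚ) : ℝ) * dWaveGap k) ^ 2) / 2) / Real.sqrt ((torusBand L₁ k - ((μ' : ℚ) : ℝ)) ^ 2 + (4 * ((g : ℚ) : ℝ) * dWaveGap k) ^ 2))) / (L₁ : ℝ) ^ 2 ≤ ((b : ℚ) : ℝ))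
    (hε : 2 * (2 * (3141593 / 10 ^ 6 : ℚ) * (3 / 2 * (2 + 4 * g))) ≤ ε * L₁)
    (hδ : 2 * (2 * (3141593 / 10 ^ 6 : ℚ) * (β * (3 + 4 * g))) ≤ δ * L₁)
    (henv : -(s - ε) - μ' + max ((μ' - μ) * (a - δ) + U * (a - δ) ^ 2 / 4) ((μ' - μ) * (b + δ) + U * (b + δ) ^ 2 / 4) ≤ e) :
    SourcedEnergyUpperRow 0 ((U : ℚ) : ℝ) ((μ : ℚ) : ℝ) (Real.sqrt 2 * (g : ℝ)) 1 L₁ e := by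
  obtain ⟨hε', hδ'⟩ := two_mul_slacks_le_of_rat L₁ hg hβ hε hδ
  refine sourcedEnergyUpperRow_sqrtTwoMul_of_kSpace_grid_of_enclosures L₁ hL₁ ((U : ℚ) : ℝ) ((μ : ℚ) : ℝ) ((μ' : ℚ) : ℝ)
    ((β : ℚ) : ℝ) (by exact_mod_cast hβ) (by exact_mod_cast hU) hg hs ha hb hε' hδ' ?_
  have h : (((-(s - ε) - μ' + max ((μ' - μ) * (a - δ) + U * (a - δ) ^ 2 / 4) ((μ' - μ) * (b + δ) + U * (b + δ) ^ 2 / 4) : ℚ)) : ℝ) ≤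
      ((e : ℚ) : ℝ) := Rat.cast_le.2 henv
  push_cast at h
  exact h

/-! ### Appendix (pin-2 g4, same day): the 20-digit `π` slack test (`Real.pi_lt_d20`), so that rows computed with a tight `π`
enclosure (the g3 uniform caps `e_g` of record) pass the rational test without loss -/

/-- `π`-free slack tests with the 20-digit bound `π < 3.14159265358979323847`. [folklore] -/
private theorem two_mul_slacks_le_of_rat20 (L₁ : ℕ) [NeZero L₁] {g β δ ε : ℚ} (hg : 0 ≤ g) (hβ : 0 ≤ β)
    (hε : 2 * (2 * (314159265358979323847 / 10 ^ 20 : ℚ) * (3 / 2 * (2 + 4 * g))) ≤ ε * L₁)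
    (hδ : 2 * (2 * (314159265358979323847 / 10 ^ 20 : ℚ) * (β * (3 + 4 * g))) ≤ δ * L₁) :
    2 * (2 * π * (3 / 2 * (2 + 4 * ((g : ℚ) : ℝ)))) / (L₁ : ℝ) ≤ ((ε : ℚ) : ℝ) ∧
      2 * (2 * π * (((β : ℚ) : ℝ) * (3 + 4 * ((g : ℚ) : ℝ)))) / (L₁ : ℝ) ≤ ((δ : ℚ) : ℝ) := by
  have hL : (0 : ℝ) < (L₁ : ℝ) := Nat.cast_pos.2 (Nat.pos_of_ne_zero (NeZero.ne L₁))
  have hg' : (0 : ℝ) ≤ (g : ℝ) := by exact_mod_cast hg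
  have hβ' : (0 : ℝ) ≤ (β : ℝ) := by exact_mod_cast hβ
  have hε' : (((2 * (2 * (314159265358979323847 / 10 ^ 20 : ℚ) * (3 / 2 * (2 + 4 * g))) : ℚ)) : ℝ) ≤ (((ε * L₁ : ℚ)) : ℝ) :=
    Rat.cast_le.2 hε
  have hδ' : (((2 * (2 * (314159265358979323847 / 10 ^ 20 : ℚ) * (β * (3 + 4 * g))) : ℚ)) : ℝ) ≤ (((δ * L₁ : ℚ)) : ℝ) :=
    Rat.cast_le.2 hδ
  push_cast at hε' hδ'
  have hπ := Real.pi_lt_d20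
  have hm1 : 0 ≤ (3 / 2 : ℝ) * (2 + 4 * (g : ℝ)) := by positivity
  have hm2 : 0 ≤ (β : ℝ) * (3 + 4 * (g : ℝ)) := by positivity
  constructor
  · rw [div_le_iff₀ hL]; nlinarith
  · rw [div_le_iff₀ hL]; nlinarith

/-- **UNIFORM-in-`L` HF–BCS cap row at a grid field from `π`-FREE certified data, 20-digit `π` test** — as
`sourcedEnergyUpperRow_sqrtTwoMul_of_kSpace_enclosures_rat` with `3.141593` replaced by `3.14159265358979323847` in the two slack tests
(loses `< 10⁻¹⁹` relative instead of `10⁻⁷`; needed to reproduce the `e_g` literals of the g3 uniform menu, whose `π` enclosure was tight).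
[cite: DavisRabinowitz1984, §2.1 eq. (2.1.6)] [cite: BachLiebSolovej1994, §2] -/
theorem sourcedEnergyUpperRow_sqrtTwoMul_of_kSpace_enclosures_rat20 (L₁ : ℕ) [NeZero L₁] (hL₁ : 3 ≤ L₁)
    {U μ μ' β g s a b δ ε e : ℚ} (hU : 0 ≤ U) (hβ : 0 ≤ β) (hg : 0 ≤ g)
    (hs : ((s : ℚ) : ℝ) ≤ (∑ k : TorusSite 2 L₁, Real.sqrt ((torusBand L₁ k - ((μ' : ℚ) : ℝ)) ^ 2 + (4 * ((g : ℚ) : ℝ) * dWaveGap k) ^ 2) * Real.tanh (((β : ℚ) : ℝ) * Real.sqrt ((torusBand L₁ k - ((μ' : ℚ) : ℝ)) ^ 2 + (4 * ((g : ℚ) : ℝ) * dWaveGap k) ^ 2) / 2)) / (L₁ : ℝ) ^ 2)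
    (ha : ((a : ℚ) : ℝ) ≤ (∑ k : TorusSite 2 L₁, (1 - (torusBand L₁ k - ((μ' : ℚ) : ℝ)) * Real.tanh (((β : ℚ) : ℝ) * Real.sqrt ((torusBand L₁ k - ((μ' : ℚ) : ℝ)) ^ 2 + (4 * ((g : ℚ) : ℝ) * dWaveGap k) ^ 2) / 2) / Real.sqrt ((torusBand L₁ k - ((μ' : ℚ) : ℝ)) ^ 2 + (4 * ((g : ℚ) : ℝ) * dWaveGap k) ^ 2))) / (L₁ : ℝ) ^ 2)
    (hb : (∑ k : TorusSite 2 L₁, (1 - (torusBand L₁ k - ((μ' : ℚ) : ℝ)) * Real.tanh (((β : ℚ) : ℝ) * Real.sqrt ((torusBand L₁ k - ((μ' : ℚ) : ℝ)) ^ 2 + (4 * ((g : ℚ) : ℝ) * dWaveGap k) ^ 2) / 2) / Real.sqrt ((torusBand L₁ k - ((μ' : ℚ) : ℝ)) ^ 2 + (4 * ((g : ℚ) : ℝ) * dWaveGap k) ^ 2))) / (L₁ : ℝ) ^ 2 ≤ ((b : ℚ) : ℝ))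
    (hε : 2 * (2 * (314159265358979323847 / 10 ^ 20 : ℚ) * (3 / 2 * (2 + 4 * g))) ≤ ε * L₁)
    (hδ : 2 * (2 * (314159265358979323847 / 10 ^ 20 : ℚ) * (β * (3 + 4 * g))) ≤ δ * L₁)
    (henv : -(s - ε) - μ' + max ((μ' - μ) * (a - δ) + U * (a - δ) ^ 2 / 4) ((μ' - μ) * (b + δ) + U * (b + δ) ^ 2 / 4) ≤ e) :
    SourcedEnergyUpperRow 0 ((U : ℚ) : ℝ) ((μ : ℚ) : ℝ) (Real.sqrt 2 * (g : ℝ)) 1 L₁ e := by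
  obtain ⟨hε', hδ'⟩ := two_mul_slacks_le_of_rat20 L₁ hg hβ hε hδ
  refine sourcedEnergyUpperRow_sqrtTwoMul_of_kSpace_grid_of_enclosures L₁ hL₁ ((U : ℚ) : ℝ) ((μ : ℚ) : ℝ) ((μ' : ℚ) : ℝ)
    ((β : ℚ) : ℝ) (by exact_mod_cast hβ) (by exact_mod_cast hU) hg hs ha hb hε' hδ' ?_
  have h : (((-(s - ε) - μ' + max ((μ' - μ) * (a - δ) + U * (a - δ) ^ 2 / 4) ((μ' - μ) * (b + δ) + U * (b + δ) ^ 2 / 4) : ℚ)) : ℝ) ≤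
      ((e : ℚ) : ℝ) := Rat.cast_le.2 henv
  push_cast at h
  exact h

end Summit.Ventures.CertifiedManyBodySolver.Observables

end
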